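import Summits.MatrixMultiplication.MatrixMultiplication.Theorems.AbelianSTPPCensusTargets
import Summits.MatrixMultiplication.OmegaCensus.LocalUSPChartBound
import Literature.Computability.AlgebraicComplexity.USPCapacityLowerBound

/-!
# Abelian STPP census — upper-end rows (cell mm-stpp, item U-1 of BRACKET-N2-SCOPING.md §3; census-silent)

CENSUS-SILENT BOOKKEEPING, kit 0, no new definitions.  The census columns of record are LOWER ends
(`NoAbelianSTPPHostUpTo τ M` for the certified ranges `M`).  This file records the UPPER end that the
tree already proves implicitly: for every exponent `τ` above the Coppersmith–Winograd chart limit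
`log_8 (4000/27) = 2.4036…`, SOME finite abelian group hosts an STPP family beating `τ`, i.e.
`∃ M, ¬ NoAbelianSTPPHostUpTo τ M`; in particular at the census tiers `τ = 247/100` (T_D) and `τ = 5/2` (T_E).
No host order is computed (the witness width `k` comes from the probabilistic local-USP construction);
nothing here is a census number, an `ω` statement, or a claim about any specific order.

Chain (every link tree-proved): `exists_localUSP_card_ge_pow` (CKSU 2005 §6.2 / Thm 13: local USPs of
rate `C` for every `C < 3/2^{2/3}`) → the CW `Cyc_m`-chart (`OmegaCensus.cwChart_isHChart`,
`cwChart_hypergraph`, `cwChart_card_mul`: blocks of volume `(m-2)^k` in `(ℤ/m)^k`) →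
`CohnKleinbergSzegedyUmans2005_thm37` (the blocks form an STPP family) → the census sum is
`s · (m-2)^{kτ/3} ≥ (C (m-2)^{τ/3})^k > m^k = |H|` as soon as `m < C (m-2)^{τ/3}` and `k ≥ 1`.
This is the unspoken middle of pub-omega's `OmegaCensus.mul_rpow_le_pow_of_isLocalUSP` (which continues
through CKSU Thm 5.5 to `ω`); here we stop before Thm 5.5 and negate the census inequality instead.
Instances: `m = 11`, `C = 37/20` with the exact certificate `11^50 < (37/20)^50 · 9^41`
(i.e. `11 < 1.85 · 9^{41/50}`, exponent `41/50 = (123/50)/3`), whence every `τ ≥ 123/50 = 2.46`;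
and the sharp chart threshold `m = 10`, `C ↑ 3/2^{2/3}`: every `τ > log_8 (4000/27)`.

WHAT THIS IS / IS NOT (lead plan g22, STATUS 2026-08-29T13:00:39Z): an UPPER-END row of the census bracket —
some abelian host `(ℤ/11)^k` (order `11^k`, `k` not computed) carries an STPP family whose packing sum at
`τ = 247/100` (and at every `τ ≥ 123/50`, in particular `5/2`) exceeds `|H|`: CKSU 2005's local-USP construction
restated in the census's own predicate `NoAbelianSTPPHostUpTo`.  Census-silent until folded (folding waits for
the director's review ruling, REVIEW-BRIEF-g22 D2); no `ω` statement; not a column; the T_D / T_E rows of the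
memo become two-sided only at the fold.  `--supports stmt-MatrixMultiplication-19191` helper; kit 0.

References: Cohn–Kleinberg–Szegedy–Umans 2005 (arXiv:math/0511460) §6.2–6.3, Def. 36, Thm 37;
Coppersmith–Winograd 1990 §6.  Cell memo: `run/shared/lean/pub/mm-stpp/mm-stpp-plan/BRACKET-N2-SCOPING.md` §1.1, §3.
-/

set_option linter.dupNamespace false -- `MatrixMultiplication.MatrixMultiplication` (summit = problem, D-0017)
set_option autoImplicit false

noncomputable section

open Finset
open scoped Pointwise
open Literature.Computability.AlgebraicComplexity
open Summit.MatrixMultiplication.OmegaCensus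

namespace Summit.MatrixMultiplication.MatrixMultiplication.Theorems

/-- **Upper-end row, general form.** If local USPs of rate `C < 3/2^{2/3}` exist (they do, tree-proved) and
the modulus `m ≥ 2` satisfies `m < C · (m-2)^{τ/3}`, then some finite abelian group (namely `(ℤ/m)^k` for a
suitable width `k ≥ 1`) hosts an STPP family beating `τ`: `∃ M, ¬ NoAbelianSTPPHostUpTo τ M`.
Proof: CW chart blocks + CKSU Thm 37; the census sum of the `s ≥ C^k` blocks of volume `(m-2)^k` is
`≥ (C (m-2)^{τ/3})^k > m^k`. Census-silent (no order is computed).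
[cite: CohnKleinbergSzegedyUmans2005, §6.3 and Thm 37 (p. 11)] -/
theorem exists_abelianSTPPHost_beating_of_rate {m : ℕ} (hm : 2 ≤ m) {C τ : ℝ} (hC0 : 0 < C)
    (hC : C < 3 / (2 : ℝ) ^ (2 / 3 : ℝ)) (hbeat : (m : ℝ) < C * ((m : ℝ) - 2) ^ (τ / 3)) :
    ∃ M, ¬ NoAbelianSTPPHostUpTo τ M := by
  classical
  obtain ⟨k, hk1, s, row, hU, hs⟩ := exists_localUSP_card_ge_pow C hC0 hC 1
  haveI : NeZero m := ⟨by omega⟩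
  haveI : Fact (1 < m) := ⟨by omega⟩
  refine ⟨m ^ k, fun hNo => ?_⟩
  -- the CW chart at modulus `m` and its STPP family of `s` blocks in `(ZMod m)^k`
  set A : Fin 3 → Finset (ZMod m) := ![{0}, {1}, univ \ {0, 1}] with hA
  set B : Fin 3 → Finset (ZMod m) := ![-(univ \ {0, 1}), {0}, {0}] with hB
  set C' : Fin 3 → Finset (ZMod m) := ![{0}, univ \ {0, 1}, {0}] with hC'
  have hChart : IsHChart A B C' := cwChart_isHChart m
  have hL : IsLocalChartUSP A B C' row := by
    intro u v w hne
    obtain ⟨i, hi⟩ := hU u v w (by tauto)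
    exact ⟨i, cwChart_hypergraph m _ _ _ hi⟩
  have hST := CohnKleinbergSzegedyUmans2005_thm37 hChart hL
  have hcardH : Fintype.card (Fin k → ZMod m) = m ^ k := by
    rw [Fintype.card_fun, ZMod.card, Fintype.card_fin]
  have h := hNo (Fin k → ZMod m) hcardH.le s (chartBlock A row) (chartBlock B row) (chartBlock C' row) hST
  rw [hcardH] at h
  have hblk : ∀ i : Fin s, (chartBlock A row i).card * (chartBlock B row i).card *
      (chartBlock C' row i).card = (m - 2) ^ k := by
    intro i
    simp only [chartBlock, Fintype.card_piFinset]
    rw [← Finset.prod_mul_distrib, ← Finset.prod_mul_distrib]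
    rw [Finset.prod_congr rfl (fun c _ => cwChart_card_mul m (row i c)), Finset.prod_const,
      Finset.card_univ, Fintype.card_fin]
  simp_rw [hblk] at h
  rw [Finset.sum_const, Finset.card_univ, Fintype.card_fin, nsmul_eq_mul] at h
  -- `h : s · ((m-2)^k)^(τ/3) ≤ m^k` over `ℝ`
  have hX0 : (0 : ℝ) ≤ (m : ℝ) - 2 := by
    have : (2 : ℝ) ≤ m := by exact_mod_cast hm
    linarith
  have hcast : ((((m - 2) ^ k : ℕ) : ℝ)) = ((m : ℝ) - 2) ^ k := by
    rw [Nat.cast_pow, Nat.cast_sub hm, Nat.cast_ofNat]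
  rw [hcast, Nat.cast_pow] at h
  have hpow : (((m : ℝ) - 2) ^ k) ^ (τ / 3) = (((m : ℝ) - 2) ^ (τ / 3)) ^ k := by
    rw [← Real.rpow_natCast, ← Real.rpow_mul hX0, mul_comm, Real.rpow_mul hX0, Real.rpow_natCast]
  rw [hpow] at h
  -- lower bound `(C (m-2)^{τ/3})^k ≤ s ((m-2)^{τ/3})^k` and the strict `m^k < (C (m-2)^{τ/3})^k` (`k ≥ 1`)
  have hY0 : (0 : ℝ) ≤ ((m : ℝ) - 2) ^ (τ / 3) := Real.rpow_nonneg hX0 _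
  have hlow : (C * ((m : ℝ) - 2) ^ (τ / 3)) ^ k ≤ (s : ℝ) * (((m : ℝ) - 2) ^ (τ / 3)) ^ k := by
    rw [mul_pow]
    exact mul_le_mul_of_nonneg_right hs (pow_nonneg hY0 _)
  have hm0 : (0 : ℝ) ≤ (m : ℝ) := by positivity
  have hstrict : (m : ℝ) ^ k < (C * ((m : ℝ) - 2) ^ (τ / 3)) ^ k :=
    pow_lt_pow_left₀ hbeat hm0 (by omega)
  linarith

/-- The rate certificate at modulus `11`: `11 < (37/20) · 9^e` for every `e ≥ 41/50`, from the exact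
comparison `11^50 < (37/20)^50 · 9^41` (i.e. `220^50 < 37^50 · 9^41`) and monotonicity of `9^e`.
[bookkeeping] -/
theorem eleven_lt_rate_mul_rpow {e : ℝ} (he : (41 / 50 : ℝ) ≤ e) :
    (11 : ℝ) < 37 / 20 * (9 : ℝ) ^ e := by
  have hexp : ((9 : ℝ) ^ (41 / 50 : ℝ)) ^ (50 : ℕ) = (9 : ℝ) ^ (41 : ℕ) := by
    rw [← Real.rpow_natCast, ← Real.rpow_mul (by norm_num : (0 : ℝ) ≤ 9)]
    rw [show ((41 / 50 : ℝ) * ((50 : ℕ) : ℝ)) = ((41 : ℕ) : ℝ) by norm_num, Real.rpow_natCast]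
  have h1 : (11 : ℝ) < 37 / 20 * (9 : ℝ) ^ (41 / 50 : ℝ) := by
    refine lt_of_pow_lt_pow_left₀ 50 (by positivity) ?_
    rw [mul_pow, hexp]
    norm_num
  have h2 : (9 : ℝ) ^ (41 / 50 : ℝ) ≤ 9 ^ e := Real.rpow_le_rpow_of_exponent_le (by norm_num) he
  nlinarith [h2]

/-- `37/20 < 3/2^{2/3}` (the CW local-USP capacity), by cubing: `37^3 · 4 = 202 612 < 216 000 = 27 · 20^3`.
[bookkeeping] -/
theorem rate_lt_uspCapacity : (37 / 20 : ℝ) < 3 / (2 : ℝ) ^ (2 / 3 : ℝ) := by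
  have h2 : (0 : ℝ) < (2 : ℝ) ^ (2 / 3 : ℝ) := by positivity
  rw [lt_div_iff₀ h2]
  have hexp : ((2 : ℝ) ^ (2 / 3 : ℝ)) ^ (3 : ℕ) = (2 : ℝ) ^ (2 : ℕ) := by
    rw [← Real.rpow_natCast, ← Real.rpow_mul (by norm_num : (0 : ℝ) ≤ 2)]
    rw [show ((2 / 3 : ℝ) * ((3 : ℕ) : ℝ)) = ((2 : ℕ) : ℝ) by norm_num, Real.rpow_natCast]
  refine lt_of_pow_lt_pow_left₀ 3 (by norm_num) ?_
  rw [mul_pow, hexp]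
  norm_num

/-- **Upper-end row for every `τ ≥ 123/50 = 2.46`** (covers the census tiers T_D `247/100` and T_E `5/2`):
some finite abelian group hosts an STPP family beating `τ` — modulus `11`, rate `37/20`, CW chart.
Census-silent: no order computed; not an `ω` statement. [cite: CohnKleinbergSzegedyUmans2005, §6.3 and Thm 37 (p. 11)] -/
theorem exists_abelianSTPPHost_beating_of_le {τ : ℝ} (hτ : 123 / 50 ≤ τ) :
    ∃ M, ¬ NoAbelianSTPPHostUpTo τ M := by
  refine exists_abelianSTPPHost_beating_of_rate (m := 11) (by norm_num) (C := 37 / 20) (by norm_num)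
    rate_lt_uspCapacity ?_
  have h := eleven_lt_rate_mul_rpow (e := τ / 3) (by linarith)
  have e9 : (((11 : ℕ) : ℝ) - 2) = 9 := by norm_num
  rw [e9]
  exact_mod_cast h

/-- **U-1 (tier T_D):** some finite abelian group hosts an STPP family beating `τ = 2.47`, i.e. the T_D onset
`M*(247/100)` is finite: `∃ M, ¬ NoAbelianSTPPHostUpTo (247/100) M`. Census-silent (no order computed).
[cite: CohnKleinbergSzegedyUmans2005, §6.3 and Thm 37 (p. 11)] -/
theorem exists_abelianSTPPHost_beating_247 : ∃ M, ¬ NoAbelianSTPPHostUpTo (247 / 100) M :=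
  exists_abelianSTPPHost_beating_of_le (by norm_num)

/-- **U-1′ (tier T_E):** some finite abelian group hosts an STPP family beating `τ = 5/2`:
`∃ M, ¬ NoAbelianSTPPHostUpTo (5/2) M`. Census-silent (no order computed).
[cite: CohnKleinbergSzegedyUmans2005, §6.3 and Thm 37 (p. 11)] -/
theorem exists_abelianSTPPHost_beating_250 : ∃ M, ¬ NoAbelianSTPPHostUpTo (5 / 2) M :=
  exists_abelianSTPPHost_beating_of_le (by norm_num)

/-- **Upper-end row at the sharp chart threshold:** for every `τ > log_8 (4000/27) = 2.4036…` (the value of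
the CW chart at the USP capacity `3/2^{2/3}` and modulus `10`), some finite abelian group hosts an STPP family
beating `τ`. (`(10 / (3/2^{2/3}))^3 = 4000/27`, so `τ > log_8 (4000/27)` is exactly `10 < (3/2^{2/3}) · 8^{τ/3}`,
and a rate `C` strictly between `10 / 8^{τ/3}` and the capacity does it.) Census-silent; not an `ω` statement
(pub-omega's `omega_le_logb_eight` is the `ω` form of the same chain).
[cite: CohnKleinbergSzegedyUmans2005, §6.3 and Thm 37 (p. 11)] -/
theorem exists_abelianSTPPHost_beating {τ : ℝ} (hτ : Real.logb 8 (4000 / 27) < τ) :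
    ∃ M, ¬ NoAbelianSTPPHostUpTo τ M := by
  have hc₀ : (0 : ℝ) < 3 / (2 : ℝ) ^ (2 / 3 : ℝ) := by positivity
  have hP : (0 : ℝ) < (8 : ℝ) ^ (τ / 3) := by positivity
  -- `4000/27 < 8^τ = (8^{τ/3})^3`
  have h8 : (4000 / 27 : ℝ) < (8 : ℝ) ^ τ := by
    have hlog : (4000 / 27 : ℝ) = (8 : ℝ) ^ Real.logb 8 (4000 / 27) := by
      rw [Real.rpow_logb (by norm_num) (by norm_num) (by norm_num)]
    rw [hlog]
    exact Real.rpow_lt_rpow_of_exponent_lt (by norm_num) hτ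
  have h8' : (8 : ℝ) ^ τ = ((8 : ℝ) ^ (τ / 3)) ^ (3 : ℕ) := by
    rw [← Real.rpow_natCast, ← Real.rpow_mul (by norm_num : (0 : ℝ) ≤ 8)]
    congr 1
    push_cast
    ring
  -- `(10 / c₀)^3 = 4000/27`
  have hq : (10 / (3 / (2 : ℝ) ^ (2 / 3 : ℝ))) ^ (3 : ℕ) = 4000 / 27 := by
    have hexp : ((2 : ℝ) ^ (2 / 3 : ℝ)) ^ (3 : ℕ) = (2 : ℝ) ^ (2 : ℕ) := by
      rw [← Real.rpow_natCast, ← Real.rpow_mul (by norm_num : (0 : ℝ) ≤ 2)]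
      rw [show ((2 / 3 : ℝ) * ((3 : ℕ) : ℝ)) = ((2 : ℕ) : ℝ) by norm_num, Real.rpow_natCast]
    rw [div_div_eq_mul_div, div_pow, mul_pow, hexp]
    norm_num
  have hlt : 10 / (3 / (2 : ℝ) ^ (2 / 3 : ℝ)) < (8 : ℝ) ^ (τ / 3) := by
    refine lt_of_pow_lt_pow_left₀ 3 hP.le ?_
    rw [hq, ← h8']
    exact h8
  -- a rate strictly between `10 / 8^{τ/3}` and the capacity
  have hlow : 10 / (8 : ℝ) ^ (τ / 3) < 3 / (2 : ℝ) ^ (2 / 3 : ℝ) := by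
    rw [div_lt_iff₀ hP]
    rw [div_lt_iff₀ hc₀] at hlt
    linarith
  obtain ⟨C, hC1, hC2⟩ := exists_between hlow
  have hC0 : 0 < C := lt_trans (by positivity) hC1
  refine exists_abelianSTPPHost_beating_of_rate (m := 10) (by norm_num) hC0 hC2 ?_
  have e8 : (((10 : ℕ) : ℝ) - 2) = 8 := by norm_num
  rw [e8, Nat.cast_ofNat]
  rw [div_lt_iff₀ hP] at hC1
  linarith

end Summit.MatrixMultiplication.MatrixMultiplication.Theorems

end
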